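import Summits.Schanuel.Schanuel.Theorems.RootDecomp1KHyper63

/-!
# RootDecomp1KHyper — lens 6, generation 17 «BILOG STAIRCASE CELL» (BilogStair.lean edition 4 d7e974ba…, 3617 l; §K–§M) — continuation (RootDecomp1KHyper64): §K `caseII_outer` — the OUTER HALF of TRANSFER II with growing degree, DECIDED (fact-free beyond the tree-PROVED `pi_measure`; `maxHeartbeats 1600000` as in the source)

(lens-6 g17 `BilogStair.lean` EDITION 4, sha256 d7e974ba…2880, 3617 l, own farm rc 0 · 0 warn · 0 sorry · axioms std; §A–§J = edition 2 (ported as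
`RootDecomp1KHyper53`–`62`), §K appended in edition 3 (critic ACK STATUS L1751: additive, reshape rule respected, PORT may proceed; L1762),
§L–§M appended in edition 4 (NODE/EDITION4 L1765, statement diff 0 removed / 0 changed / 20 added); port by census-1 gen 16 in parts
`RootDecomp1KHyper63`–`66` — 63 = §K `PB` closure lemmas + `piMeasure_fin1` + `caseII_outer_core`, 64 = §K `caseII_outer`, 65 = §L `InnerNormII` /
`ZeroTransferII` (Prop defs, typed pieces) + `transferII_of_pieces` (PROVED), 66 = §M `zeroTransferII_holds` (PROVED) + `transferII_of_innerNorm`.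
PORT edits: the source's `one_le_mvlen_of_ne_zero` is the tree's `RootDecomp1KHyper03.one_le_mvlen` (deleted, two call sites re-pointed);
`le_exp_self'` / `transcendental_pi_complex` / `exists_aeval_ne_zero` private (generic one-liners with tree twins; per-part private copies);
eleven one-line docstrings added; `set_option linter.dupNamespace false` dropped; statements and proofs otherwise verbatim.
INSTRUMENTS of record, NO credit (critic L1751/L1763: TransferI/TransferII remain typed UNDECIDED; TransferII proved as typed = one theorem credit).
`--supports stmt-Schanuel-33363`; nothing here proves Schanuel; rung 0.)
-/

open Complex Polynomial IntermediateField Filter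
open scoped BigOperators

namespace Summit.Schanuel.Schanuel.Theorems.RootDecomp1KHyper

namespace HyperCell

namespace LatCell

namespace Bilog

variable {n : ℕ}
open Summit.Schanuel.Schanuel.Theorems.RootDecomp1KRelLiouvilleCell (mvPolyMeasure_one_of_polyMeasure ycoeff
  mvaeval_cons_eq_sum mvlen_ycoeff_le natDegree_finSuccEquiv_le_totalDegree norm_mvaeval_le_mvlen_mul_pow)

/-- `x ≤ exp x`. -/
private theorem le_exp_self' (x : ℝ) : x ≤ Real.exp x := by linarith [Real.add_one_le_exp x]

set_option maxHeartbeats 1600000 in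
/-- **TWISTED ELIMINATION WITH GROWING DEGREE (DECIDED — the outer half of TRANSFER II).**  `Φ ≠ 0`, `Φ(π, ℓ) = 0`,
`b_k > 0` eventually; `N_k ∈ ℤ[x₁, x₂] ∖ 0` with `deg N_k ≤ H_k^c`, `mvlen N_k ≤ exp(H_k^c)` and
`‖N_k(π, a_kπ + b_kℓ)‖ < exp(−H_k^m)` for every `m` (eventually in `k`).  THEN eventually `N_k(π, a_kπ + b_kρ) = 0` for some
root `ρ` of `Φ(π, ·)`.  [Ingredients: `caseII_outer_core` (twist + eliminant + product formula), the degree-explicit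
measure of `π` (`piMeasure_fin1`), and the `PB` clash.] -/
theorem caseII_outer {ℓ : ℝ} {a b : ℕ → ℚ} (hb : ∀ᶠ k in atTop, 0 < b k)
    (Φ : MvPolynomial (Fin 2) ℤ) (hΦ : Φ ≠ 0) (hΦ0 : MvPolynomial.aeval ![(Real.pi : ℂ), (ℓ : ℂ)] Φ = 0)
    (N : ℕ → MvPolynomial (Fin 2) ℤ) (c : ℕ) (hN0 : ∀ᶠ k in atTop, N k ≠ 0)
    (hNdeg : ∀ᶠ k in atTop, ((N k).totalDegree : ℝ) ≤ hgt a b k ^ c)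
    (hNlen : ∀ᶠ k in atTop, ((mvlen (N k) : ℤ) : ℝ) ≤ Real.exp (hgt a b k ^ c))
    (hNsmall : ∀ m : ℕ, ∀ᶠ k in atTop,
      ‖MvPolynomial.aeval ![(Real.pi : ℂ), (a k : ℂ) * Real.pi + (b k : ℂ) * ℓ] (N k)‖ <
        Real.exp (-(hgt a b k) ^ m)) :
    ∀ᶠ k in atTop, ∃ ρ : ℂ, MvPolynomial.aeval ![(Real.pi : ℂ), ρ] Φ = 0 ∧
      MvPolynomial.aeval ![(Real.pi : ℂ), (a k : ℂ) * Real.pi + (b k : ℂ) * ρ] (N k) = 0 := by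
  classical
  obtain ⟨C₁, C₂, hC₁, hC₂, hcore⟩ := caseII_outer_core (a := a) (b := b) Φ hΦ hΦ0
  have hC₂0 : 0 ≤ C₂ := by linarith
  set EΦ := (toPoly Φ).natDegree with hEΦ
  -- the sequences of the bookkeeping
  obtain ⟨A, hA⟩ : ∃ A : ℕ → ℤ, A = fun k => (a k).num * (b k).den := ⟨_, rfl⟩
  obtain ⟨B, hB⟩ : ∃ B : ℕ → ℤ, B = fun k => (b k).num * (a k).den := ⟨_, rfl⟩
  obtain ⟨E, hE⟩ : ∃ E : ℕ → ℕ, E = fun k => (a k).den * (b k).den := ⟨_, rfl⟩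
  obtain ⟨K, hK⟩ : ∃ K : ℕ → ℕ, K = fun k => (toPoly (N k)).natDegree := ⟨_, rfl⟩
  obtain ⟨D, hD⟩ : ∃ D : ℕ → ℕ, D = fun k => (N k).totalDegree := ⟨_, rfl⟩
  obtain ⟨R, hR⟩ : ∃ R : ℕ → MvPolynomial (Fin 1) ℤ, R = fun k => resII Φ (N k) (A k) (B k) (E k) :=
    ⟨_, rfl⟩
  obtain ⟨d, hd⟩ : ∃ d : ℕ → ℕ, d = fun k => (EΦ + K k) * max Φ.totalDegree (D k) + 1 := ⟨_, rfl⟩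
  obtain ⟨B₀, hB₀⟩ : ∃ B₀ : ℕ → ℝ, B₀ = fun k =>
      ((((EΦ + 1 : ℕ) : ℤ) * mvlen Φ * ((E k : ℤ) + |A k| + |B k|) ^ EΦ + mvlen (N k) : ℤ) : ℝ) :=
    ⟨_, rfl⟩
  obtain ⟨M, hM⟩ : ∃ M : ℕ → ℝ, M = fun k => ((mvlen (R k) : ℤ) : ℝ) := ⟨_, rfl⟩
  obtain ⟨Λ, hΛ⟩ : ∃ Λ : ℕ → ℝ, Λ = fun k => ((d k : ℝ) + 1) * M k + 3 := ⟨_, rfl⟩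
  obtain ⟨ψ, hψ⟩ : ∃ ψ : ℕ → ℝ, ψ = fun k =>
      2 * 10 ^ 6 * (d k : ℝ) * (Real.log (Λ k) + d k * Real.log (d k)) * (1 + Real.log (d k)) := ⟨_, rfl⟩
  obtain ⟨ε, hε⟩ : ∃ ε : ℕ → ℝ, ε = fun k =>
      ‖MvPolynomial.aeval ![(Real.pi : ℂ), (a k : ℂ) * Real.pi + (b k : ℂ) * ℓ] (N k)‖ := ⟨_, rfl⟩
  obtain ⟨P₁, hP₁⟩ : ∃ P₁ : ℕ → ℝ, P₁ = fun k =>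
      (K k : ℝ) * (C₁ + 2 * EΦ * hgt a b k) + EΦ * (hgt a b k ^ c + D k * (C₂ * hgt a b k)) := ⟨_, rfl⟩
  -- elementary facts (all `k`)
  have hH3 : ∀ k, 3 ≤ hgt a b k := three_le_hgt a b
  have hKD : ∀ k, K k ≤ D k := fun k => by rw [hK, hD]; exact natDegree_toPoly_le _
  have hn0 : ∀ k, (0 : ℝ) ≤ (EΦ : ℝ) + K k := fun k => by positivity
  have hd1 : ∀ k, 1 ≤ d k := fun k => by rw [hd]; exact Nat.le_add_left 1 _
  have hd1R : ∀ k, (1 : ℝ) ≤ d k := fun k => by exact_mod_cast hd1 k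
  have hM0 : ∀ k, 0 ≤ M k := fun k => by rw [hM]; dsimp only; exact_mod_cast mvlen_nonneg _
  have hΛ3 : ∀ k, 3 ≤ Λ k := fun k => by
    rw [hΛ]; dsimp only
    have := hM0 k
    have : (0 : ℝ) ≤ d k := by positivity
    nlinarith
  have hEAB : ∀ k, ((E k : ℤ) : ℝ) + |(A k : ℝ)| + |(B k : ℝ)| ≤ 3 * hgt a b k ^ 2 := fun k => by
    have h1 := den_mul_den_le_hgt_sq a b k
    have h2 := num_mul_den_le_hgt_sq a b k
    rw [hE, hA, hB]; dsimp only
    push_cast at h1 h2 ⊢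
    linarith [h2.1, h2.2]
  have hlogfact : ∀ n : ℕ, Real.log (n.factorial : ℝ) ≤ (n : ℝ) * n := fun n => by
    calc Real.log (n.factorial : ℝ) ≤ Real.log ((n : ℝ) ^ n) :=
          Real.log_le_log (by positivity) (by exact_mod_cast Nat.factorial_le_pow n)
      _ = n * Real.log n := Real.log_pow _ _
      _ ≤ n * n := mul_le_mul_of_nonneg_left (Real.log_le_self (Nat.cast_nonneg n)) (Nat.cast_nonneg n)
  have hMU : ∀ k, M k ≤ ((EΦ + K k).factorial : ℝ) * B₀ k ^ (EΦ + K k) := fun k => by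
    have h := (resII_bounds Φ (N k) (A k) (B k) (E k)).1
    have h' : ((mvlen (resII Φ (N k) (A k) (B k) (E k)) : ℤ) : ℝ) ≤
        (((Nat.factorial ((toPoly Φ).natDegree + (toPoly (N k)).natDegree) : ℤ) *
          ((((toPoly Φ).natDegree + 1 : ℕ) : ℤ) * mvlen Φ * ((E k : ℤ) + |A k| + |B k|) ^ (toPoly Φ).natDegree +
            mvlen (N k)) ^ ((toPoly Φ).natDegree + (toPoly (N k)).natDegree) : ℤ) : ℝ) := by exact_mod_cast h
    rw [hM, hB₀, hR, hK]; dsimp only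
    push_cast at h' ⊢
    exact h'
  -- PB of the pieces
  have pbD : PB a b fun k => (D k : ℝ) := ⟨c, hNdeg.mono fun k hk => by rw [hD]; exact hk⟩
  have pbK : PB a b fun k => (K k : ℝ) :=
    pb_of_le pbD (Filter.Eventually.of_forall fun k => by exact_mod_cast hKD k)
  have pbn : PB a b fun k => (EΦ : ℝ) + K k := pb_add (pb_const _) pbK
  have pbd : PB a b fun k => (d k : ℝ) := by
    refine pb_of_le (pb_add (pb_mul pbn (pb_add (pb_const (Φ.totalDegree : ℝ)) pbD)
      (Filter.Eventually.of_forall hn0) (Filter.Eventually.of_forall fun k => by positivity)) (pb_const 1))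
      (Filter.Eventually.of_forall fun k => ?_)
    rw [hd]; dsimp only; push_cast
    have hmax : (max (Φ.totalDegree : ℝ) (D k : ℝ)) ≤ Φ.totalDegree + D k :=
      max_le (by linarith [Nat.cast_nonneg (α := ℝ) (D k)]) (by linarith [Nat.cast_nonneg (α := ℝ) Φ.totalDegree])
    have := mul_le_mul_of_nonneg_left hmax (hn0 k)
    linarith
  have hB₀1 : ∀ᶠ k in atTop, 1 ≤ B₀ k := hN0.mono fun k hk => by
    rw [hB₀]; dsimp only
    have h1 : (1 : ℤ) ≤ mvlen (N k) := one_le_mvlen hk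
    have h2 : (0 : ℤ) ≤ (((EΦ + 1 : ℕ) : ℤ) * mvlen Φ * ((E k : ℤ) + |A k| + |B k|) ^ EΦ) :=
      mul_nonneg (mul_nonneg (by positivity) (mvlen_nonneg _)) (pow_nonneg (by positivity) _)
    exact_mod_cast (show (1 : ℤ) ≤ _ + mvlen (N k) by linarith)
  have hlogB₀ : ∀ᶠ k in atTop, Real.log (B₀ k) ≤
      ((EΦ : ℝ) + 1) * mvlen Φ * (3 ^ EΦ * hgt a b k ^ (2 * EΦ)) + 1 + hgt a b k ^ c :=
    (hB₀1.and hNlen).mono fun k hk => by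
      obtain ⟨h1k, hlenk⟩ := hk
      set H := hgt a b k with hH
      have hH0 : 0 < H := by linarith [hH3 k]
      have hmΦ : (0 : ℝ) ≤ ((mvlen Φ : ℤ) : ℝ) := by exact_mod_cast mvlen_nonneg _
      have hS0 : 0 ≤ ((EΦ : ℝ) + 1) * mvlen Φ * (3 ^ EΦ * H ^ (2 * EΦ)) :=
        mul_nonneg (mul_nonneg (by positivity) hmΦ) (mul_nonneg (by positivity) (pow_nonneg hH0.le _))
      set S : ℝ := ((EΦ : ℝ) + 1) * mvlen Φ * (3 ^ EΦ * H ^ (2 * EΦ)) with hS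
      have hT1 : 1 ≤ Real.exp (H ^ c) := Real.one_le_exp (pow_nonneg hH0.le _)
      have hB₀le : B₀ k ≤ S + Real.exp (H ^ c) := by
        rw [hB₀]; dsimp only; push_cast
        have hX := hEAB k
        have hXnn : 0 ≤ ((E k : ℤ) : ℝ) + |(A k : ℝ)| + |(B k : ℝ)| := by positivity
        have hpow : (((E k : ℤ) : ℝ) + |(A k : ℝ)| + |(B k : ℝ)|) ^ EΦ ≤ 3 ^ EΦ * H ^ (2 * EΦ) := by
          rw [pow_mul, ← mul_pow]; exact pow_le_pow_left₀ hXnn hX _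
        push_cast at hpow hXnn
        have := mul_le_mul_of_nonneg_left hpow (show (0 : ℝ) ≤ ((EΦ : ℝ) + 1) * mvlen Φ from
          mul_nonneg (by positivity) hmΦ)
        linarith
      have hB₀pos : 0 < B₀ k := by linarith
      have hS1 : (0 : ℝ) < S + 1 := by linarith
      calc Real.log (B₀ k) ≤ Real.log ((S + 1) * Real.exp (H ^ c)) :=
            Real.log_le_log hB₀pos (by nlinarith)
        _ = Real.log (S + 1) + H ^ c := by
            rw [Real.log_mul hS1.ne' (Real.exp_pos _).ne', Real.log_exp]
        _ ≤ S + 1 + H ^ c := by linarith [Real.log_le_self hS1.le]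
  have hmΦ : (0 : ℝ) ≤ ((mvlen Φ : ℤ) : ℝ) := by exact_mod_cast mvlen_nonneg _
  have ev3 : ∀ᶠ _k : ℕ in atTop, (0 : ℝ) ≤ (3 : ℝ) ^ EΦ := Filter.Eventually.of_forall fun _ => by positivity
  have evH2 : ∀ᶠ k in atTop, (0 : ℝ) ≤ hgt a b k ^ (2 * EΦ) :=
    Filter.Eventually.of_forall fun k => pow_nonneg (by linarith [hH3 k]) _
  have evc₂ : ∀ᶠ _k : ℕ in atTop, (0 : ℝ) ≤ ((EΦ : ℝ) + 1) * mvlen Φ :=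
    Filter.Eventually.of_forall fun _ => mul_nonneg (by positivity) hmΦ
  have ev3H : ∀ᶠ k in atTop, (0 : ℝ) ≤ (3 : ℝ) ^ EΦ * hgt a b k ^ (2 * EΦ) :=
    Filter.Eventually.of_forall fun k => mul_nonneg (by positivity) (pow_nonneg (by linarith [hH3 k]) _)
  have pb_logB₀ : PB a b fun k => Real.log (B₀ k) :=
    pb_of_le (pb_add (pb_add (pb_mul (pb_const (((EΦ : ℝ) + 1) * mvlen Φ))
      (pb_mul (pb_const ((3 : ℝ) ^ EΦ)) (pb_pow_hgt (2 * EΦ)) ev3 evH2) evc₂ ev3H) (pb_const 1)) (pb_pow_hgt c))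
      hlogB₀
  have hlogB₀0 : ∀ᶠ k in atTop, 0 ≤ Real.log (B₀ k) := hB₀1.mono fun k hk => Real.log_nonneg hk
  have hlogM : ∀ᶠ k in atTop, Real.log (M k + 1) ≤
      1 + ((EΦ : ℝ) + K k) * ((EΦ : ℝ) + K k) + ((EΦ : ℝ) + K k) * Real.log (B₀ k) :=
    hB₀1.mono fun k h1 => by
      have hf1 : (1 : ℝ) ≤ ((EΦ + K k).factorial : ℝ) := by exact_mod_cast Nat.succ_le_of_lt (Nat.factorial_pos _)
      have hU1 : 1 ≤ ((EΦ + K k).factorial : ℝ) * B₀ k ^ (EΦ + K k) :=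
        one_le_mul_of_one_le_of_one_le hf1 (one_le_pow₀ h1)
      have hB₀pos : 0 < B₀ k := by linarith
      calc Real.log (M k + 1) ≤ Real.log (2 * (((EΦ + K k).factorial : ℝ) * B₀ k ^ (EΦ + K k))) :=
            Real.log_le_log (by linarith [hM0 k]) (by linarith [hMU k])
        _ = Real.log 2 + Real.log ((EΦ + K k).factorial : ℝ) + (EΦ + K k : ℕ) * Real.log (B₀ k) := by
            rw [Real.log_mul (by norm_num) (by positivity), Real.log_mul (by positivity) (by positivity),
              Real.log_pow, add_assoc]
        _ ≤ 1 + ((EΦ : ℝ) + K k) * ((EΦ : ℝ) + K k) + ((EΦ : ℝ) + K k) * Real.log (B₀ k) := by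
            have h2 : Real.log 2 ≤ 1 := by linarith [Real.log_le_sub_one_of_pos (by norm_num : (0 : ℝ) < 2)]
            have h3 := hlogfact (EΦ + K k)
            push_cast at h3 ⊢
            linarith
  have hlogΛ : ∀ᶠ k in atTop, Real.log (Λ k) ≤ ((d k : ℝ) + 4) +
      (1 + ((EΦ : ℝ) + K k) * ((EΦ : ℝ) + K k) + ((EΦ : ℝ) + K k) * Real.log (B₀ k)) :=
    hlogM.mono fun k hk => by
      have hd0 : (0 : ℝ) ≤ d k := by positivity
      have hΛle : Λ k ≤ ((d k : ℝ) + 4) * (M k + 1) := by rw [hΛ]; dsimp only; nlinarith [hM0 k]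
      calc Real.log (Λ k) ≤ Real.log (((d k : ℝ) + 4) * (M k + 1)) :=
            Real.log_le_log (by linarith [hΛ3 k]) hΛle
        _ = Real.log ((d k : ℝ) + 4) + Real.log (M k + 1) :=
            Real.log_mul (by positivity) (by linarith [hM0 k])
        _ ≤ _ := add_le_add (Real.log_le_self (by positivity)) hk
  have pb_logΛ : PB a b fun k => Real.log (Λ k) :=
    pb_of_le (pb_add (pb_add pbd (pb_const 4)) (pb_add (pb_add (pb_const 1) (pb_mul pbn pbn
      (Filter.Eventually.of_forall hn0) (Filter.Eventually.of_forall hn0)))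
      (pb_mul pbn pb_logB₀ (Filter.Eventually.of_forall hn0) hlogB₀0))) hlogΛ
  have hlogΛ0 : ∀ k, 0 ≤ Real.log (Λ k) := fun k => Real.log_nonneg (by linarith [hΛ3 k])
  have hψle : ∀ k, ψ k ≤ 2 * 10 ^ 6 * (d k : ℝ) * (Real.log (Λ k) + d k * d k) * (1 + d k) := fun k => by
    rw [hψ]; dsimp only
    have hd0 : (0 : ℝ) ≤ d k := by positivity
    have hld : Real.log (d k) ≤ d k := Real.log_le_self hd0
    have hld0 : 0 ≤ Real.log (d k) := Real.log_nonneg (hd1R k)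
    have h1 : Real.log (Λ k) + d k * Real.log (d k) ≤ Real.log (Λ k) + d k * d k := by nlinarith
    have h2 : 1 + Real.log (d k) ≤ 1 + d k := by linarith
    have h0 : 0 ≤ Real.log (Λ k) + d k * Real.log (d k) := by nlinarith [hlogΛ0 k]
    calc 2 * 10 ^ 6 * (d k : ℝ) * (Real.log (Λ k) + d k * Real.log (d k)) * (1 + Real.log (d k))
        = 2 * 10 ^ 6 * (d k : ℝ) * ((Real.log (Λ k) + d k * Real.log (d k)) * (1 + Real.log (d k))) := by ring
      _ ≤ 2 * 10 ^ 6 * (d k : ℝ) * ((Real.log (Λ k) + d k * d k) * (1 + d k)) :=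
          mul_le_mul_of_nonneg_left (mul_le_mul h1 h2 (by positivity) (by nlinarith [hlogΛ0 k])) (by positivity)
      _ = _ := by ring
  have pbψ : PB a b ψ := by
    refine pb_of_le (pb_mul (pb_mul (pb_mul (pb_const _) pbd (Filter.Eventually.of_forall fun k => by positivity)
      (Filter.Eventually.of_forall fun k => by positivity)) (pb_add pb_logΛ (pb_mul pbd pbd
      (Filter.Eventually.of_forall fun k => by positivity) (Filter.Eventually.of_forall fun k => by positivity)))
      (Filter.Eventually.of_forall fun k => by positivity)
      (Filter.Eventually.of_forall fun k => by nlinarith [hlogΛ0 k, hd1R k]))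
      (pb_add (pb_const 1) pbd) (Filter.Eventually.of_forall fun k => ?_)
      (Filter.Eventually.of_forall fun k => by positivity)) (Filter.Eventually.of_forall hψle)
    have : (0 : ℝ) ≤ d k := by positivity
    have := hlogΛ0 k
    positivity
  have pbP₁ : PB a b P₁ := by
    rw [hP₁]
    exact pb_add (pb_mul pbK (pb_add (pb_const C₁) (pb_mul (pb_const _) pb_hgt
      (Filter.Eventually.of_forall fun k => by positivity) (Filter.Eventually.of_forall fun k => by
        linarith [hH3 k])))
      (Filter.Eventually.of_forall fun k => by positivity)
      (Filter.Eventually.of_forall fun k => by nlinarith [hH3 k]))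
      (pb_mul (pb_const _) (pb_add (pb_pow_hgt c) (pb_mul pbD (pb_mul (pb_const C₂) pb_hgt
        (Filter.Eventually.of_forall fun k => hC₂0) (Filter.Eventually.of_forall fun k => by linarith [hH3 k]))
        (Filter.Eventually.of_forall fun k => by positivity)
        (Filter.Eventually.of_forall fun k => by nlinarith [hH3 k])))
        (Filter.Eventually.of_forall fun k => by positivity)
        (Filter.Eventually.of_forall fun k => by
          have := hH3 k
          have : 0 ≤ (D k : ℝ) * (C₂ * hgt a b k) :=
            mul_nonneg (Nat.cast_nonneg _) (mul_nonneg hC₂0 (by linarith))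
          have : 0 ≤ hgt a b k ^ c := pow_nonneg (by linarith) _
          positivity))
  have hε0 : ∀ᶠ k in atTop, 0 ≤ ε k := Filter.Eventually.of_forall fun k => by rw [hε]; exact norm_nonneg _
  have hεsmall : ∀ m : ℕ, ∀ᶠ k in atTop, ε k < Real.exp (-(hgt a b k) ^ m) := fun m =>
    (hNsmall m).mono fun k hk => by rw [hε]; exact hk
  have hclash := pb_clash (pb_add pbψ pbP₁) hεsmall hε0
  -- the final argument
  filter_upwards [hclash, hb, hN0, hNlen] with k hcl hbk hNk hlenk
  rcases hcore k hbk (N k) hNk with h | ⟨hres, hup⟩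
  · exact h
  · exfalso
    have hRk : R k = resII Φ (N k) ((a k).num * (b k).den) ((b k).num * (a k).den) ((a k).den * (b k).den) := by
      rw [hR, hA, hB, hE]
    rw [← hRk] at hres hup
    rw [show (toPoly (N k)).natDegree = K k by rw [hK], show (N k).totalDegree = D k by rw [hD]] at hup
    set H := hgt a b k with hH
    have hH0 : 0 < H := by linarith [hH3 k]
    have hMN0 : 0 ≤ ((mvlen (N k) : ℤ) : ℝ) := by exact_mod_cast mvlen_nonneg _
    -- UPPER ≤ exp(P₁ k) · ε k
    have hU1 : (C₁ * H ^ (2 * EΦ)) ^ K k ≤ Real.exp ((K k : ℝ) * (C₁ + 2 * EΦ * H)) := by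
      have h1 : C₁ * H ^ (2 * EΦ) ≤ Real.exp (C₁ + 2 * EΦ * H) := by
        rw [Real.exp_add]
        refine mul_le_mul (le_exp_self' C₁) ?_ (by positivity) (by positivity)
        calc H ^ (2 * EΦ) ≤ Real.exp H ^ (2 * EΦ) := pow_le_pow_left₀ hH0.le (le_exp_self' H) _
          _ = Real.exp (2 * EΦ * H) := by rw [← Real.exp_nat_mul]; push_cast; ring_nf
      calc (C₁ * H ^ (2 * EΦ)) ^ K k ≤ Real.exp (C₁ + 2 * EΦ * H) ^ K k :=
            pow_le_pow_left₀ (by positivity) h1 _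
        _ = Real.exp ((K k : ℝ) * (C₁ + 2 * EΦ * H)) := by rw [← Real.exp_nat_mul]
    have hU2 : (((mvlen (N k) : ℤ) : ℝ) * (C₂ * H) ^ D k) ^ EΦ ≤
        Real.exp ((EΦ : ℝ) * (H ^ c + D k * (C₂ * H))) := by
      have h1 : ((mvlen (N k) : ℤ) : ℝ) * (C₂ * H) ^ D k ≤ Real.exp (H ^ c + D k * (C₂ * H)) := by
        rw [Real.exp_add]
        refine mul_le_mul hlenk ?_ (by positivity) (by positivity)
        calc (C₂ * H) ^ D k ≤ Real.exp (C₂ * H) ^ D k := pow_le_pow_left₀ (by positivity) (le_exp_self' _) _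
          _ = Real.exp (D k * (C₂ * H)) := by rw [← Real.exp_nat_mul]
      calc (((mvlen (N k) : ℤ) : ℝ) * (C₂ * H) ^ D k) ^ EΦ ≤ Real.exp (H ^ c + D k * (C₂ * H)) ^ EΦ :=
            pow_le_pow_left₀ (mul_nonneg hMN0 (by positivity)) h1 _
        _ = Real.exp ((EΦ : ℝ) * (H ^ c + D k * (C₂ * H))) := by rw [← Real.exp_nat_mul]
    have hup' : ‖MvPolynomial.aeval ![(Real.pi : ℂ)] (R k)‖ ≤ Real.exp (P₁ k) * ε k := by
      rw [hP₁, hε]; dsimp only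
      rw [Real.exp_add]
      refine hup.trans ?_
      exact mul_le_mul (mul_le_mul hU1 hU2 (by positivity) (by positivity)) le_rfl (norm_nonneg _)
        (by positivity)
    -- LOWER ≥ exp(−ψ k): the degree-explicit measure of `π`
    have hRdeg : (R k).totalDegree ≤ d k := by
      rw [hd, hR, hK, hD]; dsimp only
      exact (resII_bounds Φ (N k) (A k) (B k) (E k)).2.trans (Nat.le_succ _)
    have hΛk : ((d k : ℝ) + 1) * ((mvlen (R k) : ℤ) : ℝ) + 3 ≤ Λ k := by rw [hΛ, hM]
    have hlow : Real.exp (-ψ k) ≤ ‖MvPolynomial.aeval ![(Real.pi : ℂ)] (R k)‖ := by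
      rw [hψ]; exact piMeasure_fin1 (R k) hres (hd1 k) hRdeg hΛk
    have h1 : (1 : ℝ) ≤ Real.exp (ψ k + P₁ k) * ε k := by
      calc (1 : ℝ) = Real.exp (ψ k) * Real.exp (-ψ k) := by rw [← Real.exp_add, add_neg_cancel, Real.exp_zero]
        _ ≤ Real.exp (ψ k) * (Real.exp (P₁ k) * ε k) :=
            mul_le_mul_of_nonneg_left (hlow.trans hup') (by positivity)
        _ = Real.exp (ψ k + P₁ k) * ε k := by rw [Real.exp_add]; ring
    linarith

end Bilog
end LatCell
end HyperCell
end Summit.Schanuel.Schanuel.Theorems.RootDecomp1KHyper
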